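import Literature.AnabelianGeometry.AbsoluteAnabelian.AutHolomorphicSpacesProofs
import Literature.AnabelianGeometry.AbsoluteAnabelian.Coorientations
import Mathlib.RingTheory.Algebraic.Basic
import HarnessLib

/-!
# [IUTchI] Rmk 3.4.3 (ii): the RE-TYPED record of an Aut-holomorphic space with NF-points
# (post-freeze ADDITIVE module; repair of finding F-L6t15g4-1, abc-iut-L5-lead RULINGS #39 (2))

S. Mochizuki, *Inter-universal Teichmüller theory I*, §3, Remark 3.4.3 (ii), kurims p. 83: "the set of
NF-points [i.e., points defined over a number field] of the underlying topological space of the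
Aut-holomorphic space `D_v` may be reconstructed via a functorial algorithm from the [abstract]
Aut-holomorphic space `D_v`" [cite: Mochizuki2012, Rmk 3.4.3 (ii) p.83] [claim: Mochizuki2012, status:
disputed].

WHY THIS FILE.  The frozen typing `S3RemarksLocal.AutHolSpaceNF` (`ThetaHodgeTheatersRemarksA2.lean`,
abc-iut-L3-t8) records an Aut-holomorphic space by ONE subgroup of global self-homeomorphisms, so its
`IsIso` only asks a homeomorphism to normalise that group — at the genuine model `P¹_ℚ ∖ {0,1,∞}` a FINITE
group (`Aut^hol(ℂ ∖ {0,1}) = S₃`, `Literature.Analysis.Complex.ThricePuncturedSphereAutomorphisms`, in the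
tree), which cannot control NF-points (abc-iut finding F-L6t15g4-1, abc-iut-L5-lead RULINGS #39 (2); the
kernel witness against the frozen reading `NFPointsFunctorial` and the kernel proof of print's reading
are the companion files `AutHolSpaceNFFunctorialityNegative.lean` / `AutHolSpaceNFFunctorialityRepaired.lean`
of the same seat — filed in this series; if they are not yet in the tree when this is read: STAGED, TO
FOLLOW).  Following [AbsTopIII] Def. 2.1 (i), (ii) and Rmk 2.1.2
(model-implicit carrier: "an Aut-holomorphic structure is the assignment `U ↦ 𝒜_X(U)` on connected open
subsets"; abc-iut-L4 `AutHolStructure`, `IsMorphism`), the record is re-typed ADDITIVELY here — the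
frozen file is not edited and its refuted declaration stays as a settled negative edge:

* `S3RemarksLocal.AutHolSpaceNFStr` — carrier, topology, an `AutHolStructure` on the carrier (the
  full assignment `W ↦ 𝒜(W)` on connected opens), and the subset of NF-points;
* `S3RemarksLocal.AutHolSpaceNFStr.IsIso` — a homeomorphism that is a morphism of Aut-holomorphic
  spaces in BOTH directions ([AbsTopIII] Def. 2.1 (ii)); `isIso_iff` (the second clause is automatic,
  abc-iut-L4 `IsMorphism.symm`), `isIso_refl` (via abc-iut-L4 `AutHolStructure.isMorphism_id`);
* `NFPointsFunctorial'` — Rmk 3.4.3 (ii)'s "reconstructed via a functorial algorithm from the abstract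
  Aut-holomorphic space", verbatim over the re-typed `IsIso`: every isomorphism carries NF-points onto
  NF-points (a predicate; NOT asserted);
* `S3RemarksLocal.AutHolSpaceNFStr.nonempty_model` — the genuine model (`ℂ ∖ {0,1}` with the
  Aut-holomorphic structure OF THE RIEMANN SURFACE, `AutHolStructure.ofCharted`, and its `ℚ̄`-points)
  inhabits the record; that `NFPointsFunctorial'` HOLDS there is the subject of the companion files
  `AutHolSpaceNFFunctorialityRepaired.lean` / `AutHolSpaceNFRetypedModel.lean` (same series; staged, to
  follow if not yet in the tree) — nothing about it is asserted HERE.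

Statements-first (D-0014): definitions and `Prop`-valued predicates only; nothing of [IUTchI] is
asserted; no side taken on [IUTchIII] Cor. 3.12.  Seat abc-iut-L6-t15 gen 4 (GO: L5-lead RULINGS #39).
-/

noncomputable section

namespace Literature.IUT.HodgeTheaters

open _root_.TopologicalSpace (Opens)
open Literature.AnabelianGeometry.AbsoluteAnabelian

universe u

namespace S3RemarksLocal

/-- **Re-typed shape for [IUTchI] Rmk 3.4.3 (ii)**: an Aut-holomorphic space in the sense of
[AbsTopIII] Def. 2.1 (i) / Rmk 2.1.2 — a topological space TOGETHER WITH its Aut-holomorphic structure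
`W ↦ 𝒜(W) ≤ Aut(W^top)` on all connected open subsets (abc-iut-L4 `AutHolStructure`; for a Riemann
surface `X`, `AutHolStructure.ofCharted X`) — with a marked subset of NF-points ("points defined over a
number field", p. 83).  Additive successor of the frozen `AutHolSpaceNF`, whose single field
`autHol : Subgroup (carrier ≃ₜ carrier)` forgets the local structure (abc-iut finding F-L6t15g4-1).
[cite: Mochizuki2012, Rmk 3.4.3 (ii) p.83] [claim: Mochizuki2012, status: disputed] -/
structure AutHolSpaceNFStr where
  /-- the underlying topological space `X^top` -/
  carrier : Type u
  /-- its topology -/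
  [instTop : TopologicalSpace carrier]
  /-- the Aut-holomorphic structure: `W ↦ 𝒜(W)` on connected opens ([AbsTopIII] Def. 2.1 (i)) -/
  str : @AutHolStructure carrier instTop
  /-- the NF-points -/
  nfPoints : Set carrier

attribute [instance] AutHolSpaceNFStr.instTop

/-- An **isomorphism of Aut-holomorphic spaces** `X ⥲ Y` ([AbsTopIII] Def. 2.1 (ii)): a homeomorphism
of the underlying spaces which is a morphism of Aut-holomorphic spaces in both directions, i.e. which
transports `𝒜_X(W)` onto `𝒜_Y(α W)` for EVERY connected open `W` (abc-iut-L4 `IsMorphism`).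
[cite: Mochizuki2012, Rmk 3.4.3 (ii) p.83] [claim: Mochizuki2012, status: disputed] -/
def AutHolSpaceNFStr.IsIso (X Y : AutHolSpaceNFStr.{u}) (α : X.carrier ≃ₜ Y.carrier) : Prop :=
  IsMorphism X.str Y.str α ∧ IsMorphism Y.str X.str α.symm

/-- The second clause of `IsIso` is automatic: a homeomorphism that is a morphism of Aut-holomorphic
spaces has a morphism as inverse (abc-iut-L4 `IsMorphism.symm`).
[cite: Mochizuki2012, Rmk 3.4.3 (ii) p.83] -/
theorem AutHolSpaceNFStr.isIso_iff (X Y : AutHolSpaceNFStr.{u}) (α : X.carrier ≃ₜ Y.carrier) :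
    AutHolSpaceNFStr.IsIso X Y α ↔ IsMorphism X.str Y.str α :=
  ⟨fun h => h.1, fun h => ⟨h, h.symm⟩⟩

/-- The identity is an isomorphism of abstract Aut-holomorphic spaces, so `NFPointsFunctorial' X X` is
never vacuous on that account. [cite: Mochizuki2012, Rmk 3.4.3 (ii) p.83] -/
theorem AutHolSpaceNFStr.isIso_refl (X : AutHolSpaceNFStr.{u}) :
    AutHolSpaceNFStr.IsIso X X (Homeomorph.refl X.carrier) :=
  (AutHolSpaceNFStr.isIso_iff X X _).mpr (AutHolStructure.isMorphism_id X.str)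

end S3RemarksLocal

/-- **Rmk 3.4.3 (ii), re-typed reading** (consequence of "holomorphic Belyi cuspidalization"): "the set of
NF-points … may be reconstructed via a functorial algorithm from the [abstract] Aut-holomorphic space" —
every ISOMORPHISM OF AUT-HOLOMORPHIC SPACES (of the full structures, [AbsTopIII] Def. 2.1 (ii)) carries
NF-points onto NF-points.  A predicate on a pair of re-typed spaces; NOT asserted here (its instance at
the genuine model `P¹_ℚ ∖ {0,1,∞}` is the companion file `AutHolSpaceNFRetypedModel.lean` of this series —
staged, to follow if not yet in the tree).
[cite: Mochizuki2012, Rmk 3.4.3 (ii) p.83] [claim: Mochizuki2012, status: disputed] -/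
def NFPointsFunctorial' (X Y : S3RemarksLocal.AutHolSpaceNFStr.{u}) : Prop :=
  ∀ α : X.carrier ≃ₜ Y.carrier, S3RemarksLocal.AutHolSpaceNFStr.IsIso X Y α →
    α '' X.nfPoints = Y.nfPoints

/-- **The genuine model inhabits the re-typed record**: the Aut-holomorphic space of the hyperbolic
curve `P¹_ℚ ∖ {0,1,∞}` — carrier the Riemann surface `ℂ ∖ {0,1}` (open subset of `ℂ`), `str :=` ITS
Aut-holomorphic structure `AutHolStructure.ofCharted` (`W ↦ Aut^hol(W)` for every connected open `W`,
[AbsTopIII] Def. 2.1 (i)), `nfPoints :=` the `ℚ̄`-points. [cite: Mochizuki2012, Rmk 3.4.3 (ii) p.83] -/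
theorem S3RemarksLocal.AutHolSpaceNFStr.nonempty_model :
    ∃ X : S3RemarksLocal.AutHolSpaceNFStr.{0},
      X = { carrier := ↥(⟨{z : ℂ | z ≠ 0 ∧ z ≠ 1}, isOpen_ne.inter isOpen_ne⟩ : Opens ℂ)
            str := AutHolStructure.ofCharted
              ↥(⟨{z : ℂ | z ≠ 0 ∧ z ≠ 1}, isOpen_ne.inter isOpen_ne⟩ : Opens ℂ)
            nfPoints := {x | IsAlgebraic ℚ (x : ℂ)} } :=
  ⟨_, rfl⟩

end Literature.IUT.HodgeTheaters

end
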